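import Summits.FinalStateConjecture.FinalStateConjecture.Theorems.BulkKerrCapture.Negative.SpinGapAndMass
import Summits.FinalStateConjecture.FinalStateConjecture.Theorems.NearExtremalKappaCapture.Negative.ExponentMonotonicity

/-!
# `BulkKerrCapture` (stmt-FinalStateConjecture-10696, route PhaseMixingCapture) — negative-side
# lemmas IV: monotonicity of the capture body in its exponents and the normal form of the crux

Refuter seat `refuter-cdisprove-stmt-FinalStateConjecture-10696-g2-0` (standing disprover, cycle 2),
2026-08-16; workfile `Cruxes/BulkKerrCapture/Disproof.lean` §2b. Nothing here closes the item.

* `CaptureAt.mono` — the conclusion block `CaptureAt s δ k M hM ε C a` of `SpinGapAndMass.lean` is an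
  UP-SET in `(s, δ)` (the data distance is monotone in `(s, δ)`: `dataWeightedSobolevEDist_mono` of
  the sister file `NearExtremalKappaCapture/Negative/ExponentMonotonicity.lean`), a DOWN-SET in `k`
  (`Spacetime.ConvergesTo.of_le`), antitone in the radius `ε` and monotone in the constant `C ≥ 0`.
* `bulkKerrCapture_iff_normalForm s₀ δ₀` — the crux is equivalent to its restriction to exponents
  `s ≥ s₀`, `δ ≥ δ₀` (ANY prescribed bounds), `C⁰` convergence `k = 0`, radii `ε ≤ 1`, constants
  `C ≥ 0`: the crux IS its own high-regularity / fast-decay member.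
* `bulkKerrCapture_iff_diagonal` — one-exponent form `s = δ = N`, `k = 0`.
* `not_bulkKerrCapture_iff` — what a disproof must show: for some `a₁ < 1`, failure at EVERY
  diagonal order `N`. A mechanism confined below a fixed Sobolev order (e.g. multi-black-hole data,
  which lie in `H^s_δ`-balls only for `s < 3/2`) can never refute the crux.

References: Bartnik, CPAM 39 (1986), (1.2) (weighted Sobolev norms); Hintz arXiv:2606.28253,
Thm. 13.1 (the vendored theorem fixes a large regularity `d` — matched by taking `s₀ = d`).
-/

-- the problem namespace `FinalStateConjecture.FinalStateConjecture` (single-conjunct summit) trips dupNamespace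
set_option linter.dupNamespace false

noncomputable section

open Set
open scoped Manifold ENNReal ContDiff

namespace Summit.FinalStateConjecture.FinalStateConjecture.Theorems.BulkKerrCapture.Negative

open Literature.Geometry.Lorentzian
open Summit.FinalStateConjecture.FinalStateConjecture.Theses.PhaseMixingCapture (BulkKerrCapture)

/-- **Monotonicity of the capture body in all its parameters.** Larger `(s, δ)` shrink the ball and
enlarge the argument of the modulus, smaller `k` weakens the convergence, smaller `ε` shrinks the
ball, larger `C ≥ 0` weakens the modulus. [folklore] -/
theorem CaptureAt.mono [Kerr.Facts] [Kerr.SliceFacts] {s s' : ℕ} {δ δ' : ℝ} {k k' : ℕ} {M : ℝ}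
    {hM : 0 ≤ M} {ε ε' C C' a : ℝ} (hs : s ≤ s') (hδ : δ ≤ δ') (hk : k' ≤ k) (hε : ε' ≤ ε)
    (hC0 : 0 ≤ C) (hC : C ≤ C') (h : CaptureAt s δ k M hM ε C a) :
    CaptureAt s' δ' k' M hM ε' C' a := by
  intro D _ hvac hdist 𝒟 hmax
  have hmono := Theorems.NearExtremalKappaCapture.Negative.dataWeightedSobolevEDist_mono hs hδ D
    (Kerr.data M a M hM)
  have hdist₀ : InitialDataSet.dataWeightedSobolevEDist s δ D (Kerr.data M a M hM) <
      ENNReal.ofReal ε :=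
    lt_of_le_of_lt hmono (hdist.trans_le (ENNReal.ofReal_le_ofReal hε))
  obtain ⟨M', a', 𝒟oc, hsub, hfar, hconv, hpar⟩ := h D hvac hdist₀ 𝒟 hmax
  refine ⟨M', a', 𝒟oc, hsub, hfar, Spacetime.ConvergesTo.of_le hconv hk, hpar.trans ?_⟩
  have hfin : InitialDataSet.dataWeightedSobolevEDist s' δ' D (Kerr.data M a M hM) ≠ ⊤ :=
    (hdist.trans_le le_top).ne
  have hle : (InitialDataSet.dataWeightedSobolevEDist s δ D (Kerr.data M a M hM)).toReal ≤
      (InitialDataSet.dataWeightedSobolevEDist s' δ' D (Kerr.data M a M hM)).toReal :=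
    ENNReal.toReal_mono hfin hmono
  calc C * √(InitialDataSet.dataWeightedSobolevEDist s δ D (Kerr.data M a M hM)).toReal
      ≤ C * √(InitialDataSet.dataWeightedSobolevEDist s' δ' D (Kerr.data M a M hM)).toReal :=
        mul_le_mul_of_nonneg_left (Real.sqrt_le_sqrt hle) hC0
    _ ≤ C' * √(InitialDataSet.dataWeightedSobolevEDist s' δ' D (Kerr.data M a M hM)).toReal :=
        mul_le_mul_of_nonneg_right hC (Real.sqrt_nonneg _)

/-- WLOG `C ≥ 0`: replacing `C` by `max C 0` preserves the capture body. [folklore] -/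
theorem CaptureAt.max_zero [Kerr.Facts] [Kerr.SliceFacts] {s : ℕ} {δ : ℝ} {k : ℕ} {M : ℝ}
    {hM : 0 ≤ M} {ε C a : ℝ} (h : CaptureAt s δ k M hM ε C a) :
    CaptureAt s δ k M hM ε (max C 0) a := by
  intro D _ hvac hdist 𝒟 hmax
  obtain ⟨M', a', 𝒟oc, hsub, hfar, hconv, hpar⟩ := h D hvac hdist 𝒟 hmax
  exact ⟨M', a', 𝒟oc, hsub, hfar, hconv,
    hpar.trans (mul_le_mul_of_nonneg_right (le_max_left _ _) (Real.sqrt_nonneg _))⟩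

/-- **Normal form of the crux.** `BulkKerrCapture` is equivalent to its restriction to exponents
`s ≥ s₀`, `δ ≥ δ₀` for ANY prescribed `(s₀, δ₀)`, `C⁰` convergence (`k = 0`), balls of radius
`ε ≤ 1` and moduli with `C ≥ 0`. In particular the crux IS its own high-regularity member: the
existential `s` may always be taken above any Sobolev threshold. [folklore] -/
theorem bulkKerrCapture_iff_normalForm (s₀ : ℕ) (δ₀ : ℝ) :
    BulkKerrCapture ↔
      ∀ [Kerr.Facts] [Kerr.SliceFacts], ∀ a₁ : ℝ, a₁ < 1 → ∃ s ≥ s₀, ∃ δ ≥ δ₀,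
        ∀ (M : ℝ) (hM : 0 < M), ∃ ε > (0 : ℝ), ε ≤ 1 ∧ ∃ C ≥ (0 : ℝ), ∀ a : ℝ, |a| ≤ a₁ * M →
          CaptureAt s δ 0 M hM.le ε C a := by
  rw [bulkKerrCapture_iff]
  constructor
  · intro h _ _ a₁ ha₁
    obtain ⟨s, δ, k, hk⟩ := h a₁ ha₁
    refine ⟨max s s₀, le_max_right _ _, max δ δ₀, le_max_right _ _, fun M hM ↦ ?_⟩
    obtain ⟨ε, hε, C, hC⟩ := hk M hM
    refine ⟨min ε 1, lt_min hε one_pos, min_le_right _ _, max C 0, le_max_right _ _,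
      fun a ha ↦ ?_⟩
    exact (hC a ha).max_zero.mono (le_max_left _ _) (le_max_left _ _) (Nat.zero_le k)
      (min_le_left _ _) (le_max_right _ _) le_rfl
  · intro h _ _ a₁ ha₁
    obtain ⟨s, -, δ, -, hk⟩ := h a₁ ha₁
    refine ⟨s, δ, 0, fun M hM ↦ ?_⟩
    obtain ⟨ε, hε, -, C, -, hC⟩ := hk M hM
    exact ⟨ε, hε, C, hC⟩

/-- **Diagonal one-exponent form.** `BulkKerrCapture` iff for every `a₁ < 1` ONE natural number
`N` serves as Sobolev order and decay weight at once, with `C⁰` convergence. [folklore] -/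
theorem bulkKerrCapture_iff_diagonal :
    BulkKerrCapture ↔
      ∀ [Kerr.Facts] [Kerr.SliceFacts], ∀ a₁ : ℝ, a₁ < 1 → ∃ N : ℕ,
        ∀ (M : ℝ) (hM : 0 < M), ∃ ε > (0 : ℝ), ∃ C : ℝ, ∀ a : ℝ, |a| ≤ a₁ * M →
          CaptureAt N (N : ℝ) 0 M hM.le ε C a := by
  rw [bulkKerrCapture_iff]
  constructor
  · intro h _ _ a₁ ha₁
    obtain ⟨s, δ, k, hk⟩ := h a₁ ha₁
    refine ⟨max s ⌈δ⌉₊, fun M hM ↦ ?_⟩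
    obtain ⟨ε, hε, C, hC⟩ := hk M hM
    refine ⟨ε, hε, max C 0, fun a ha ↦ ?_⟩
    have hδN : δ ≤ ((max s ⌈δ⌉₊ : ℕ) : ℝ) :=
      (Nat.le_ceil δ).trans (by exact_mod_cast le_max_right s ⌈δ⌉₊)
    exact (hC a ha).max_zero.mono (le_max_left _ _) hδN (Nat.zero_le k) le_rfl
      (le_max_right _ _) le_rfl
  · intro h _ _ a₁ ha₁
    obtain ⟨N, hN⟩ := h a₁ ha₁
    exact ⟨N, N, 0, hN⟩

/-- **What a disproof must show.** Granted the two instance facts, `¬ BulkKerrCapture` iff for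
SOME `a₁ < 1` capture fails at EVERY diagonal order `N` — for each `N` some mass `M > 0` admits no
ball radius and constant at all. [folklore] -/
theorem not_bulkKerrCapture_iff [hF : Kerr.Facts] [hS : Kerr.SliceFacts] :
    ¬ BulkKerrCapture ↔
      ∃ a₁ : ℝ, a₁ < 1 ∧ ∀ N : ℕ, ∃ (M : ℝ) (hM : 0 < M), ∀ ε > (0 : ℝ), ∀ C : ℝ,
        ∃ a : ℝ, |a| ≤ a₁ * M ∧ ¬ CaptureAt N (N : ℝ) 0 M hM.le ε C a := by
  rw [bulkKerrCapture_iff_diagonal]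
  constructor
  · intro h
    by_contra hcon
    push Not at hcon
    exact h fun {_ _} a₁ ha₁ ↦ by
      obtain ⟨N, hN⟩ := hcon a₁ ha₁
      exact ⟨N, fun M hM ↦ by
        obtain ⟨ε, hε, C, hC⟩ := hN M hM
        exact ⟨ε, hε, C, fun a ha ↦ by
          have := hC a ha
          convert this⟩⟩
  · rintro ⟨a₁, ha₁, h⟩ h'
    obtain ⟨N, hN⟩ := @h' hF hS a₁ ha₁
    obtain ⟨M, hM, hM'⟩ := h N
    obtain ⟨ε, hε, C, hC⟩ := hN M hM
    obtain ⟨a, ha, hna⟩ := hM' ε hε C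
    exact hna (hC a ha)

end Summit.FinalStateConjecture.FinalStateConjecture.Theorems.BulkKerrCapture.Negative

end
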